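import Literature.AlgebraicGeometry.Motives.HodgeThetaAnnihilatorSemisimpleTimesAbelian
import Literature.AlgebraicGeometry.ComplexMultiplication.CMTypeCommutantHOne
import Literature.AlgebraicGeometry.HodgeTheory.RealCharactersSlotsHodgeClasses
import Literature.AlgebraicGeometry.HodgeTheory.HOneOfProductEndomorphismBlocks
import Literature.AlgebraicGeometry.HodgeTheory.AbelianVarietyHodgeNumbers
import HarnessLib

/-!
# Hodge classes on abelian varieties with slots over `A × C`, `A` with real `𝔰𝔩₂`-block data and `C` of CM type: the invariance theorem — the coefficient tensor is killed by `⊕_τ 𝔰𝔩(V_τ)` at the `A`-places (Lombardo 2016 Lemma 3.4 / Moonen–Zarhin 1999 (3.1), Lie step; Hazama 1983 §3)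

Family `hodge`, layer `Literature/AlgebraicGeometry/HodgeTheory`. Research context: cell `pub-hodge-ring2`
(HONEST FRAMING: research route conditional on HC_CM; not a corollary; Q11.4-sentence-2 already refuted in
dim ≥ 3), Literature lane, programme R4 («RM × CM»). UNCONDITIONAL (`hHD`, `hI` are the tree theorems
`exists_isReal_hodgeModel_holds`, `hodgePQ_independent_of_hodgeModel_holds`, kept as arguments as in the whole
Betti universe); theorems only, no named fact; no step towards a summit statement.

PRINTED RESULT. Lombardo 2016, Lemma 3.4 (p. 1229): «Suppose `B` is of CM type and `A_K̄` has no simple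
factor of type IV. Then `H(A × B) ≅ H(A) × H(B)`»; with Moonen–Zarhin 1999 §3 (3.1) the Hodge ring of every
`A^m × B^n` is then generated by the classes coming from the factors. This file is the LIE STEP of that
statement on tensors, for `A` a carrier of real `𝔰𝔩₂`-block data (Hazama 1983 §3: `H¹(A, ℂ) = ⊕ V_i`,
`𝔥 = 𝔰𝔩₂ × ⋯ × 𝔰𝔩₂`; e.g. `End⁰(A)` a totally real field of degree `dim A`, Ribet 1983) and `C` of CM type
(`Milne1999.IsOfCMType`), in the tree's word model and with the abstract Lie step
`HodgeStructure.wordDerAt_assemble_eq_zero_of_semisimple_times_abelian` (`Motives/HodgeThetaAnnihilatorSemisimpleTimesAbelian`).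

MAIN RESULT `AVSlots.exists_coeff_killed_at_real_places_of_prod_cmType`. Let `X` carry a slot structure `g`
over `A × C` (e.g. `X = (A × C)^{N+1}`, `AVSlots.powSucc`). The LETTERS of `X` are `g_j^* pr_A^* b_τ^r`
(`b_τ` Hodge-adapted bases of the real blocks `V_τ` of `H¹(A) ⊗ ℂ`, places `τ ∈ T`) and `g_j^* pr_C^* c_i^r`
(`(c_i^0, c_i^1)_i` a basis of `H¹(C) ⊗ ℂ` with `c_i^0 ∈ H^{1,0}`, `c_i^1 ∈ H^{0,1}`, places `i ∈ Fin h`).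
Then every rational `(p,p)`-class on `X` (`p ≥ 1`) is `∑_w a(w) · (letters)_w` for a coefficient function
`a` on words in the letters `((j, t), r)`, `t ∈ T ⊕ Fin h`, such that for every slot-and-place word `U`, every
`A`-place `τ` and every trace-free `N ∈ M₂(ℂ)`, the operator `N` placed at the positions of place `inl τ`
kills the slice `a(U, −)` — the `C`-places carry NO condition («`H(B)` is a torus»).

PROOF = the tree's `AVSlots.exists_invariant_coeff_of_real_characters` (Ribet/Hazama, file
`RealCharactersSlotsHodgeClasses`) with `A` replaced by `A × C` and THEOREM L replaced by the product Lie
step: §1 a basis of `H¹(A × C) ⊗ ℂ` from the presentation `pr_A^* ⊕ pr_C^*` (Künneth in degree one,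
`HOneOfProductEndomorphismBlocks`) and block matrices read in it (`toMatrix_eq_blockLift_of_apply_basis`);
§2 a Hodge-adapted PAIR basis of `H¹(C) ⊗ ℂ = H^{1,0} ⊕ H^{0,1}` (`h^{1,0} = h^{0,1}`); §3 the theorem: kind-
balanced antisymmetric coefficients, base change to rational letters, `Θ ∈ 𝔞_ℂ`, the abstract Lie step fed
with Riemann (`unop_bettiRep_mem_endAlg`) and the CM commutant (`IsOfCMType.exists_commutant_comm`:
`End_S(H¹(C)) = S` is commutative), transport back to the adapted letters.

## References

* [Lombardo2016] D. Lombardo, Ann. Inst. Fourier 66 (2016), Lemma 3.4 (p. 1229). [cite: Lombardo2016, Lemma 3.4 (p. 1229)]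
* [MoonenZarhin1999LowDim] B. Moonen, Yu. Zarhin, Math. Ann. 315 (1999), §3 (3.1)–(3.2).
  [cite: MoonenZarhin1999LowDim, §3 (3.1)]
* [Hazama1983] F. Hazama, Tôhoku Math. J. 35 (1983), Thm. (1.1), §3 pp. 305–306. [cite: Hazama1983, §3 (pp. 305–306)]
* [Ribet1983] K. A. Ribet, Amer. J. Math. 105 (1983), Thm. 0–1. [cite: Ribet1983, Thm. 0–1]
* [Deligne1982HodgeCycles] P. Deligne, LNM 900 (1982), I §3 Prop. 3.4, §4 p. 30. [cite: Deligne1982HodgeCycles, I §3 Prop. 3.4]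
* [VoisinHodgeI2002] C. Voisin, *Hodge Theory I*, §7.1.1, §7.3.2, §11.3.3 Thm. 11.38. [cite: VoisinHodgeI2002, §7.3.2]
* [GoodmanWallachGTM255] R. Goodman, N. R. Wallach, GTM 255, §4.1.1. [cite: GoodmanWallachGTM255, §4.1.1]
-/

noncomputable section

open scoped TensorProduct
open CategoryTheory Module

namespace Literature.AlgebraicGeometry.HodgeTheory

open Literature.AlgebraicTopology.SingularHomology
open Literature.AlgebraicGeometry.Motives (IsSmoothProjective AbelianVariety bettiCohomology
  ofRatClassBaseChange ofRatClassBaseChange_tmul HodgeTensorFacts hodgeTensorFacts_holds)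
open Literature.Barriers.HodgeConjecture
open Literature.AlgebraicGeometry.Motives.HodgeStructure
open Literature.AlgebraicGeometry.ComplexMultiplication
open Literature.RepresentationTheory.GeneralLinear
open Literature.NumberTheory.DiophantineGeometry

/-! ### §1 Linear algebra of a presentation `U = ι₁V₁ ⊕ ι₂V₂`: bases and block matrices -/

section Presentation

/-- **A basis of `U` from bases of the factors of a presentation `U = ι₁V₁ ⊕ ι₂V₂`** (`π₁ι₁ = 1`,
`π₂ι₂ = 1`, `π₁ι₂ = 0`, `π₂ι₁ = 0`, `ι₁π₁ + ι₂π₂ = 1`): the vectors `ι₁ β₁(i)`, `ι₂ β₂(j)` (Künneth in degree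
one: `H¹(A × C) = pr_A^* H¹(A) ⊕ pr_C^* H¹(C)`). [cite: VoisinHodgeI2002, §11.3.3 Thm. 11.38] -/
theorem exists_basis_of_presentation {K U V₁ V₂ : Type*} [Field K] [AddCommGroup U] [Module K U]
    [AddCommGroup V₁] [Module K V₁] [AddCommGroup V₂] [Module K V₂]
    {ι₁ : V₁ →ₗ[K] U} {π₁ : U →ₗ[K] V₁} {ι₂ : V₂ →ₗ[K] U} {π₂ : U →ₗ[K] V₂}
    (h11 : π₁ ∘ₗ ι₁ = LinearMap.id) (h22 : π₂ ∘ₗ ι₂ = LinearMap.id) (h12 : π₁ ∘ₗ ι₂ = 0)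
    (h21 : π₂ ∘ₗ ι₁ = 0) (hsum : ι₁ ∘ₗ π₁ + ι₂ ∘ₗ π₂ = LinearMap.id)
    {I₁ I₂ : Type*} (β₁ : Module.Basis I₁ K V₁) (β₂ : Module.Basis I₂ K V₂) :
    ∃ e : Module.Basis (I₁ ⊕ I₂) K U, (∀ i, e (Sum.inl i) = ι₁ (β₁ i)) ∧ (∀ j, e (Sum.inr j) = ι₂ (β₂ j)) := by
  have e11 : ∀ v, π₁ (ι₁ v) = v := fun v => by
    rw [← LinearMap.comp_apply (f := π₁), h11, LinearMap.id_apply]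
  have e22 : ∀ w, π₂ (ι₂ w) = w := fun w => by
    rw [← LinearMap.comp_apply (f := π₂), h22, LinearMap.id_apply]
  have e12 : ∀ w, π₁ (ι₂ w) = 0 := fun w => by
    rw [← LinearMap.comp_apply (f := π₁), h12, LinearMap.zero_apply]
  have e21 : ∀ v, π₂ (ι₁ v) = 0 := fun v => by
    rw [← LinearMap.comp_apply (f := π₂), h21, LinearMap.zero_apply]
  let Φ : (V₁ × V₂) ≃ₗ[K] U := LinearEquiv.ofLinear (ι₁.coprod ι₂) (π₁.prod π₂)
    (by rw [LinearMap.coprod_comp_prod, hsum])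
    (by
      apply LinearMap.ext
      rintro ⟨v, w⟩
      simp only [LinearMap.comp_apply, LinearMap.coprod_apply, LinearMap.id_apply, map_add]
      change (π₁ (ι₁ v), π₂ (ι₁ v)) + (π₁ (ι₂ w), π₂ (ι₂ w)) = (v, w)
      rw [e11, e12, e21, e22, Prod.mk_add_mk, add_zero, zero_add])
  refine ⟨(β₁.prod β₂).map Φ, fun i => ?_, fun j => ?_⟩
  · rw [Module.Basis.map_apply, Module.Basis.prod_apply]
    simp [Φ]
  · rw [Module.Basis.map_apply, Module.Basis.prod_apply]
    simp [Φ]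

/-- **The matrix of an operator acting blockwise on a basis grouped in pairs is `blockLift`**: if
`Y (v_{t,c}) = ∑_a (Nf t)_{a c} v_{t,a}` for a basis `v` indexed (through `φ`) by (place, kind), then the matrix
of `Y` is `blockLift φ Nf` (generalises the tree's `toMatrix_assemble_eq_blockLift`). [cite: Hazama1983, §3 (p. 306)] -/
theorem toMatrix_eq_blockLift_of_apply_basis {K W T : Type*} [Field K] [AddCommGroup W] [Module K W]
    [Fintype T] [DecidableEq T] {M : ℕ} (φ : Fin M ≃ T × Fin 2) (cbσ : Module.Basis (Fin M) K W)
    (Nf : T → Matrix (Fin 2) (Fin 2) K) (Y : Module.End K W)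
    (hY : ∀ m, Y (cbσ m) = ∑ a, Nf (φ m).1 a (φ m).2 • cbσ (φ.symm ((φ m).1, a))) :
    LinearMap.toMatrix cbσ cbσ Y = blockLift φ Nf := by
  ext i m
  rw [LinearMap.toMatrix_apply, hY m, map_sum, Finsupp.coe_finsetSum, Finset.sum_apply, blockLift_apply]
  simp only [map_smul, Module.Basis.repr_self, Finsupp.smul_apply, Finsupp.single_apply, smul_eq_mul,
    mul_ite, mul_one, mul_zero]
  by_cases h : (φ i).1 = (φ m).1
  · rw [if_pos h, Finset.sum_eq_single (φ i).2]
    · rw [if_pos]; rw [← h, Prod.mk.eta, Equiv.symm_apply_apply]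
    · intro a _ ha
      rw [if_neg]
      intro hia
      apply ha
      have := congrArg φ hia
      rw [Equiv.apply_symm_apply] at this
      simpa [eq_comm] using congrArg Prod.snd this
    · intro hh; exact absurd (Finset.mem_univ _) hh
  · rw [if_neg h]
    refine Finset.sum_eq_zero fun a _ => ?_
    rw [if_neg]
    intro hia
    apply h
    have := congrArg φ hia
    rw [Equiv.apply_symm_apply] at this
    simpa [eq_comm] using congrArg Prod.fst this

end Presentation

/-! ### §2 A Hodge-adapted pair basis of an effective weight-one Hodge structure -/

section PairBasis

universe u

variable {V : Type u} [AddCommGroup V] [Module ℚ V] [Module.Finite ℚ V]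

/-- **`V_ℂ = V^{1,0} ⊕ V^{0,1}` with `h^{1,0} = h^{0,1}` gives a basis in PAIRS `(c_i^0, c_i^1)`,
`c_i^0 ∈ V^{1,0}`, `c_i^1 ∈ V^{0,1}`** for an effective weight-one `ℚ`-Hodge structure (Hodge symmetry
`hodgeNumber_symm_holds`, the decomposition `isCompl_piece_one_zero_piece_zero_one`; for `H¹(C)` of an
abelian variety `C`: `h = dim C`). [cite: VoisinHodgeI2002, §7.1.1] -/
theorem exists_hodgeAdapted_pairBasis {n : ℤ} (H : Motives.HodgeStructure V n) (hn : n = 1) (heff : H.IsEffective) :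
    ∃ (h : ℕ) (e : Module.Basis (Fin h × Fin 2) ℂ (ℂ ⊗[ℚ] V)),
      (∀ i, e (i, 0) ∈ H.piece 1 (n - 1)) ∧ (∀ i, e (i, 1) ∈ H.piece 0 (n - 0)) := by
  subst hn
  set P := H.piece 1 0 with hP
  set Q := H.piece 0 1 with hQ
  have hPQ : IsCompl P Q := isCompl_piece_one_zero_piece_zero_one H heff
  have hfin : Module.finrank ℂ P = Module.finrank ℂ Q := hodgeNumber_symm_holds H 1 0
  set β₁ := Module.finBasis ℂ P with hβ₁
  set β₂ : Module.Basis (Fin (Module.finrank ℂ P)) ℂ Q := Module.finBasisOfFinrankEq ℂ Q hfin.symm with hβ₂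
  set e' : Module.Basis (Fin (Module.finrank ℂ P) ⊕ Fin (Module.finrank ℂ P)) ℂ (ℂ ⊗[ℚ] V) :=
    (β₁.prod β₂).map (Submodule.prodEquivOfIsCompl P Q hPQ) with he'
  have he'l : ∀ i, e' (Sum.inl i) = (β₁ i : ℂ ⊗[ℚ] V) := fun i => by
    rw [he', Module.Basis.map_apply, Module.Basis.prod_apply]
    simp
  have he'r : ∀ i, e' (Sum.inr i) = (β₂ i : ℂ ⊗[ℚ] V) := fun i => by
    rw [he', Module.Basis.map_apply, Module.Basis.prod_apply]
    simp
  -- reindex pairs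
  let θ : Fin (Module.finrank ℂ P) ⊕ Fin (Module.finrank ℂ P) ≃ Fin (Module.finrank ℂ P) × Fin 2 :=
    { toFun := Sum.elim (fun i => (i, 0)) (fun i => (i, 1))
      invFun := fun ir => if ir.2 = 0 then Sum.inl ir.1 else Sum.inr ir.1
      left_inv := fun s => by rcases s with i | i <;> simp
      right_inv := fun ir => by
        obtain ⟨i, r⟩ := ir
        rcases (show r = 0 ∨ r = 1 by fin_cases r <;> simp) with h0 | h1
        · subst h0; simp
        · subst h1; simp }
  refine ⟨Module.finrank ℂ P, e'.reindex θ, fun i => ?_, fun i => ?_⟩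
  · have h1 : (e'.reindex θ) (i, 0) = e' (Sum.inl i) := by
      rw [Module.Basis.reindex_apply]; rfl
    rw [show (1 : ℤ) - 1 = 0 by norm_num, h1, he'l]
    exact (β₁ i).2
  · have h1 : (e'.reindex θ) (i, 1) = e' (Sum.inr i) := by
      rw [Module.Basis.reindex_apply]; rfl
    rw [show (1 : ℤ) - 0 = 1 by norm_num, h1, he'r]
    exact (β₂ i).2

end PairBasis

/-! ### §3 The invariance theorem for slots over `A × C` -/

section Invariance

variable {A C X : AbelianVariety ℂ} {n : ℕ} {g : Fin n → (X ⟶ A.prod C)}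

/-- The two elements of `Fin 2`. [folklore] -/
private theorem fin2_eq_zero_or_one'' (r : Fin 2) : r = 0 ∨ r = 1 := by
  fin_cases r <;> simp

open scoped Classical in
/-- **The INVARIANCE THEOREM for slots over `A × C`, `A` with real `𝔰𝔩₂`-block data, `C` of CM type
(Lombardo 2016 Lemma 3.4 / Moonen–Zarhin 1999 (3.1), Lie step; Hazama 1983 §3).** Let `ψ` be a polarization
of `H¹(A(ℂ); ℚ)` with `End_Hdg` self-adjoint, `σ_τ` (`τ ∈ T`) REAL characters of `End_Hdg(H¹(A))` whose
two-dimensional eigenblocks `V_τ` decompose `H¹(A) ⊗ ℂ`, `b_τ` Hodge-adapted block bases, `C` of CM type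
(`Milne1999.IsOfCMType`), and `X` an abelian variety with slots `g` over `A × C`. Then there is a Hodge-adapted
pair basis `(c_i^0, c_i^1)_{i < h}` of `H¹(C) ⊗ ℂ` (`c_i^0 ∈ H^{1,0}`, `c_i^1 ∈ H^{0,1}`) such that every
rational class `c` of type `(p,p)` on `X` (`p ≥ 1`) is `∑_w a(w) · x_w` in the letters
`x((j, inl τ), r) = g_j^* pr_A^* b_τ^r`, `x((j, inr i), r) = g_j^* pr_C^* c_i^r`, for a coefficient function `a`
such that for every slot-and-place word `U`, every `A`-place `τ` and every trace-free `N ∈ M₂(ℂ)` the operator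
`N` placed at the positions of place `inl τ` kills the slice `a(U, −)`: the tensor invariants of `X` are
invariants of `(⊕_τ 𝔰𝔩(V_τ)) ⊕ 0 ⊆ Lie Hg(A) ⊕ Lie Hg(C)` («`H(A × B) ≅ H(A) × H(B)`», `H(B)` a torus).
[cite: Lombardo2016, Lemma 3.4 (p. 1229)] [cite: MoonenZarhin1999LowDim, §3 (3.1)]
[cite: Hazama1983, Thm. (1.1) and §3 (pp. 305–306)] [cite: Ribet1983, Thm. 0–1] -/
theorem AVSlots.exists_coeff_killed_at_real_places_of_prod_cmType [HodgeTensorFacts.{0, 0}]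
    (hg : AVSlots (A.prod C) X g)
    (hHD : exists_isReal_hodgeModel) (hI : hodgePQ_independent_of_hodgeModel)
    {T : Type} [Fintype T] [DecidableEq T]
    (ψ : (BettiUniverse.hodge hHD (AbelianVariety.isSmoothProjective_holds (A := A)) 1).Polarization)
    (hself : ∀ a : (BettiUniverse.hodge hHD (AbelianVariety.isSmoothProjective_holds (A := A)) 1).endAlg,
      LinearMap.IsAdjointPair ψ.form ψ.form (a : Module.End ℚ (bettiCohomology A.X 1))
        (a : Module.End ℚ (bettiCohomology A.X 1)))
    (σ : T → ((BettiUniverse.hodge hHD (AbelianVariety.isSmoothProjective_holds (A := A)) 1).endAlg →+* ℂ))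
    (hreal : ∀ τ, (starRingEnd ℂ).comp (σ τ) = σ τ)
    (hint : DirectSum.IsInternal fun τ =>
      (BettiUniverse.hodge hHD (AbelianVariety.isSmoothProjective_holds (A := A)) 1).eigenBlock (σ τ))
    (h2 : ∀ τ, Module.finrank ℂ
      ((BettiUniverse.hodge hHD (AbelianVariety.isSmoothProjective_holds (A := A)) 1).eigenBlock (σ τ)) = 2)
    (b : ∀ τ, Module.Basis (Fin 2) ℂ
      ((BettiUniverse.hodge hHD (AbelianVariety.isSmoothProjective_holds (A := A)) 1).eigenBlock (σ τ)))
    (hb0 : ∀ τ, (b τ 0 : ℂ ⊗[ℚ] bettiCohomology A.X 1) ∈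
      (BettiUniverse.hodge hHD (AbelianVariety.isSmoothProjective_holds (A := A)) 1).piece 1 0)
    (hb1 : ∀ τ, (b τ 1 : ℂ ⊗[ℚ] bettiCohomology A.X 1) ∈
      (BettiUniverse.hodge hHD (AbelianVariety.isSmoothProjective_holds (A := A)) 1).piece 0 1)
    (hC : Milne1999.IsOfCMType C) :
    ∃ (h : ℕ) (cC : Module.Basis (Fin h × Fin 2) ℂ (ℂ ⊗[ℚ] bettiCohomology C.X 1)),
      (∀ i, cC (i, 0) ∈ (BettiUniverse.hodge hHD (AbelianVariety.isSmoothProjective_holds (A := C)) 1).piece 1 0) ∧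
      (∀ i, cC (i, 1) ∈ (BettiUniverse.hodge hHD (AbelianVariety.isSmoothProjective_holds (A := C)) 1).piece 0 1) ∧
      ∀ {p : ℕ}, 0 < p → ∀ {c : complexBetti X.X (2 * p)}, IsRationalClass c →
        IsOfHodgeType X.dim X.X (2 * p) p p c →
        ∃ a : (Fin (2 * p) → (Fin n × (T ⊕ Fin h)) × Fin 2) → ℂ,
          wordEval (cupPowOneAlt ℂ (Motives.ComplexPoints X.X) (2 * p))
            (fun jr : (Fin n × (T ⊕ Fin h)) × Fin 2 => complexBetti.map (g jr.1.1).hom.hom.hom 1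
              (Sum.elim
                (fun τ => complexBetti.map (Motives.AbelianVariety.fst A C).hom.hom.hom 1
                  (ofRatClassBaseChange (Motives.ComplexPoints A.X) 1 (b τ jr.2 : ℂ ⊗[ℚ] bettiCohomology A.X 1)))
                (fun i => complexBetti.map (Motives.AbelianVariety.snd A C).hom.hom.hom 1
                  (ofRatClassBaseChange (Motives.ComplexPoints C.X) 1 (cC (i, jr.2))))
                jr.1.2)) a = c ∧
          ∀ (U : Fin (2 * p) → Fin n × (T ⊕ Fin h)) (τ : T) (N : Matrix (Fin 2) (Fin 2) ℂ), N.trace = 0 →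
            wordDerAt ℂ (colourOp ℂ (fun t => (U t).2) (Sum.inl τ) N) (wordSlice a U) = 0 := by
  classical
  -- the setting
  have hXA : IsSmoothProjective A.dim A.X := AbelianVariety.isSmoothProjective_holds
  have hXC : IsSmoothProjective C.dim C.X := AbelianVariety.isSmoothProjective_holds
  have hXP : IsSmoothProjective (A.prod C).dim (A.prod C).X := AbelianVariety.isSmoothProjective_holds
  haveI : Module.Finite ℚ (bettiCohomology A.X 1) := finite_bettiCohomology_one A
  haveI : Module.Finite ℚ (bettiCohomology C.X 1) := finite_bettiCohomology_one C
  haveI : Module.Finite ℚ (bettiCohomology (A.prod C).X 1) := finite_bettiCohomology_one (A.prod C)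
  have hodd : Odd (((1 : ℕ) : ℤ)) := ⟨0, by norm_num⟩
  -- §2: the pair basis of `H¹(C) ⊗ ℂ`
  obtain ⟨h, cC, hcC0, hcC1⟩ := exists_hodgeAdapted_pairBasis (BettiUniverse.hodge hHD hXC 1) (by norm_num)
    (BettiUniverse.hodge_isEffective hHD hXC 1)
  have hcC0' : ∀ i, cC (i, 0) ∈ (BettiUniverse.hodge hHD hXC 1).piece 1 0 := fun i => by simpa using hcC0 i
  have hcC1' : ∀ i, cC (i, 1) ∈ (BettiUniverse.hodge hHD hXC 1).piece 0 1 := fun i => by simpa using hcC1 i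
  refine ⟨h, cC, hcC0', hcC1', ?_⟩
  intro p hp c hcQ hc
  -- the presentation `H¹(A × C) = pr_A^* H¹(A) ⊕ pr_C^* H¹(C)` and its complexification
  set ι₁ := HOneProduct.pullFst A C with hι₁
  set π₁ := HOneProduct.pullInl A C with hπ₁
  set ι₂ := HOneProduct.pullSnd A C with hι₂
  set π₂ := HOneProduct.pullInr A C with hπ₂
  have hπι₁ : π₁ ∘ₗ ι₁ = LinearMap.id := HOneProduct.pullInl_comp_pullFst
  have hπι₂ : π₂ ∘ₗ ι₂ = LinearMap.id := HOneProduct.pullInr_comp_pullSnd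
  have hπ₁ι₂ : π₁ ∘ₗ ι₂ = 0 := HOneProduct.pullInl_comp_pullSnd
  have hπ₂ι₁ : π₂ ∘ₗ ι₁ = 0 := HOneProduct.pullInr_comp_pullFst
  have hsum : ι₁ ∘ₗ π₁ + ι₂ ∘ₗ π₂ = LinearMap.id := HOneProduct.pullFst_comp_pullInl_add
  have hπι₁C : π₁.baseChange ℂ ∘ₗ ι₁.baseChange ℂ = LinearMap.id := by
    rw [← LinearMap.baseChange_comp, hπι₁, LinearMap.baseChange_id]
  have hπι₂C : π₂.baseChange ℂ ∘ₗ ι₂.baseChange ℂ = LinearMap.id := by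
    rw [← LinearMap.baseChange_comp, hπι₂, LinearMap.baseChange_id]
  have hπ₁ι₂C : π₁.baseChange ℂ ∘ₗ ι₂.baseChange ℂ = 0 := by
    rw [← LinearMap.baseChange_comp, hπ₁ι₂, LinearMap.baseChange_zero]
  have hπ₂ι₁C : π₂.baseChange ℂ ∘ₗ ι₁.baseChange ℂ = 0 := by
    rw [← LinearMap.baseChange_comp, hπ₂ι₁, LinearMap.baseChange_zero]
  have hsumC : ι₁.baseChange ℂ ∘ₗ π₁.baseChange ℂ + ι₂.baseChange ℂ ∘ₗ π₂.baseChange ℂ = LinearMap.id := by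
    rw [← LinearMap.baseChange_comp, ← LinearMap.baseChange_comp, ← LinearMap.baseChange_add, hsum,
      LinearMap.baseChange_id]
  -- piece compatibility of `pr_A^*`, `pr_C^*` (pull-backs are morphisms of Hodge structures)
  have hι₁F : ∀ q : ℤ, ∀ x ∈ (BettiUniverse.hodge hHD hXA 1).piece q (((1 : ℕ) : ℤ) - q), ι₁.baseChange ℂ x ∈ (BettiUniverse.hodge hHD hXP 1).piece q (((1 : ℕ) : ℤ) - q) :=
    fun q x hx => (BettiUniverse.pullHodgeHom hHD hI hXP hXA (Motives.AbelianVariety.fst A C).hom.hom.hom 1).map_piece_le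
      q _ ⟨x, hx, rfl⟩
  have hι₂F : ∀ q : ℤ, ∀ x ∈ (BettiUniverse.hodge hHD hXC 1).piece q (((1 : ℕ) : ℤ) - q), ι₂.baseChange ℂ x ∈ (BettiUniverse.hodge hHD hXP 1).piece q (((1 : ℕ) : ℤ) - q) :=
    fun q x hx => (BettiUniverse.pullHodgeHom hHD hI hXP hXC (Motives.AbelianVariety.snd A C).hom.hom.hom 1).map_piece_le
      q _ ⟨x, hx, rfl⟩
  -- §1: the basis `cbU` of `H¹(A × C) ⊗ ℂ` in blocks: `pr_A^* b_τ^r` and `pr_C^* c_i^r`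
  set cbA : Module.Basis (T × Fin 2) ℂ (ℂ ⊗[ℚ] bettiCohomology A.X 1) :=
    (hint.collectedBasis b).reindex (Equiv.sigmaEquivProd T (Fin 2)) with hcbA
  have hcbA_apply : ∀ τr : T × Fin 2, (cbA τr : ℂ ⊗[ℚ] bettiCohomology A.X 1) = b τr.1 τr.2 := by
    rintro ⟨τ, r⟩
    simp [cbA, DirectSum.IsInternal.collectedBasis_coe, Equiv.sigmaEquivProd]
  obtain ⟨cbx', hcbx'l, hcbx'r⟩ := exists_basis_of_presentation hπι₁C hπι₂C hπ₁ι₂C hπ₂ι₁C hsumC cbA cC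
  set cbx : Module.Basis ((T ⊕ Fin h) × Fin 2) ℂ (ℂ ⊗[ℚ] bettiCohomology (A.prod C).X 1) :=
    cbx'.reindex (Equiv.sumProdDistrib T (Fin h) (Fin 2)).symm with hcbxdef
  have hcbx : ∀ tr : (T ⊕ Fin h) × Fin 2, cbx tr =
      Sum.elim (fun τ => ι₁.baseChange ℂ (b τ tr.2 : ℂ ⊗[ℚ] bettiCohomology A.X 1))
        (fun i => ι₂.baseChange ℂ (cC (i, tr.2))) tr.1 := by
    rintro ⟨t, r⟩
    rw [hcbxdef, Module.Basis.reindex_apply, Equiv.symm_symm]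
    rcases t with τ | i
    · rw [Equiv.sumProdDistrib_apply_left, hcbx'l, hcbA_apply]; rfl
    · rw [Equiv.sumProdDistrib_apply_right, hcbx'r]; rfl
  -- Hodge-adaptedness of `cbx`
  have hcbx0 : ∀ t, cbx (t, 0) ∈ (BettiUniverse.hodge hHD hXP 1).piece 1 0 := by
    intro t
    rw [hcbx]
    rcases t with τ | i
    · exact hι₁F 1 _ (by simpa using hb0 τ)
    · exact hι₂F 1 _ (by simpa using hcC0' i)
  have hcbx1 : ∀ t, cbx (t, 1) ∈ (BettiUniverse.hodge hHD hXP 1).piece 0 1 := by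
    intro t
    rw [hcbx]
    rcases t with τ | i
    · have e : (((1 : ℕ) : ℤ) - 0) = 1 := by norm_num
      have h01 := hι₁F 0 _ (by rw [e]; exact hb1 τ)
      rwa [e] at h01
    · have e : (((1 : ℕ) : ℤ) - 0) = 1 := by norm_num
      have h01 := hι₂F 0 _ (by rw [e]; exact hcC1' i)
      rwa [e] at h01
  -- bases indexed by `Fin M`: the block basis `cbσ` and the rational basis `eC`
  set eQ := Module.finBasis ℚ (bettiCohomology (A.prod C).X 1) with heQ
  set eC : Module.Basis (Fin (Module.finrank ℚ (bettiCohomology (A.prod C).X 1))) ℂ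
    (ℂ ⊗[ℚ] bettiCohomology (A.prod C).X 1) := Algebra.TensorProduct.basis ℂ eQ with heC
  set φ : Fin (Module.finrank ℚ (bettiCohomology (A.prod C).X 1)) ≃ (T ⊕ Fin h) × Fin 2 :=
    eC.indexEquiv cbx with hφ
  set cbσ : Module.Basis (Fin (Module.finrank ℚ (bettiCohomology (A.prod C).X 1))) ℂ
    (ℂ ⊗[ℚ] bettiCohomology (A.prod C).X 1) := cbx.reindex φ.symm with hcbσdef
  have hcbσ : ∀ m, cbσ m = cbx (φ m) := fun m => by
    rw [hcbσdef, Module.Basis.reindex_apply, Equiv.symm_symm]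
  -- letters
  set ρ := ofRatClassBaseChangeEquiv hXP 1 with hρ
  set v : Module.Basis _ ℂ (complexBetti (A.prod C).X 1) := cbσ.map ρ with hv
  set eL : Module.Basis _ ℂ (complexBetti (A.prod C).X 1) := eC.map ρ with heL
  have heLQ : ∀ i, IsRationalClass (eL i) := fun i => by
    rw [heL, Module.Basis.map_apply, heC, Algebra.TensorProduct.basis_apply, hρ,
      ofRatClassBaseChangeEquiv_apply, ofRatClassBaseChange_tmul, one_smul]
    exact isRationalClass_ofRatClass _
  set κ : Fin (Module.finrank ℚ (bettiCohomology (A.prod C).X 1)) → Fin 2 := fun m => (φ m).2 with hκ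
  have hv_apply : ∀ m, v m = ofRatClassBaseChange (Motives.ComplexPoints (A.prod C).X) 1 (cbx (φ m)) := fun m => by
    rw [hv, Module.Basis.map_apply, hcbσ, hρ, ofRatClassBaseChangeEquiv_apply]
  have hv0 : ∀ m, κ m = 0 → IsOfHodgeType (A.prod C).dim (A.prod C).X 1 1 0 (v m) := by
    intro m hm
    rw [hv_apply, ← BettiUniverse.mem_hodge_piece_iff hHD hI hXP (k := 1) (p := 1) (q := 0) rfl]
    have hsplit : φ m = ((φ m).1, 0) := by
      change (φ m).2 = 0 at hm; rw [← hm]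
    rw [hsplit]
    exact hcbx0 _
  have hv1 : ∀ m, κ m = 1 → IsOfHodgeType (A.prod C).dim (A.prod C).X 1 0 1 (v m) := by
    intro m hm
    rw [hv_apply, ← BettiUniverse.mem_hodge_piece_iff hHD hI hXP (k := 1) (p := 0) (q := 1) rfl]
    have hsplit : φ m = ((φ m).1, 1) := by
      change (φ m).2 = 1 at hm; rw [← hm]
    rw [hsplit]
    exact hcbx1 _
  -- (α) an antisymmetric kind-balanced coefficient function in the adapted letters
  obtain ⟨ax, hax_bal, hax_anti, hcax⟩ := hg.exists_antisymm_kindBalanced_wordEval_eq v κ hv0 hv1 hp hc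
  -- the change of letters to the rational letters
  set G : Matrix _ _ ℂ := eC.toMatrix cbσ with hG
  set G' : Matrix _ _ ℂ := cbσ.toMatrix eC with hG'
  have hG'G : G' * G = 1 := cbσ.toMatrix_mul_toMatrix_flip eC
  have hve : ∀ m, v m = ∑ i, G i m • eL i := fun m => by
    simp only [hv, heL, Module.Basis.map_apply, ← map_smul, ← map_sum]
    congr 1
    exact (eC.sum_toMatrix_smul_self (v := ⇑cbσ) (j := m)).symm
  have hletters : ∀ j m, avLetters g v (j, m) = ∑ i, G i m • avLetters g eL (j, i) :=
    avLetters_baseChange g G hve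
  set aE := colourChangeAt (fun _ : Fin n => G) ax with haE
  have haE_anti : IsAntisymm aE := hax_anti.colourChangeAt _
  have hcaE : wordEval (cupPowOneAlt ℂ (Motives.ComplexPoints X.X) (2 * p)) (avLetters g eL) aE = c := by
    rw [haE, ← wordEval_eq_wordEval_colourChangeAt _ (fun _ : Fin n => G) hletters ax, hcax]
  -- rationality of `aE`
  have hFinj : Function.Injective (exteriorPower.alternatingMapLinearEquiv
      (cupPowOneAlt ℂ (Motives.ComplexPoints X.X) (2 * p))) :=
    injective_alternatingMapLinearEquiv_cupPowOneAlt X (2 * p)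
  obtain ⟨q, hq⟩ := hg.exists_rat_wordEval_eq eL heLQ hcQ
  obtain ⟨q', -, haEq⟩ := haE_anti.exists_eq_algebraMap_of_wordEval_eq hFinj (hg.letterBasis eL)
    (q := q) (by rw [AVSlots.coe_letterBasis, hcaE, hq])
  have hslice_e : ∀ u, wordSlice aE u = wordRepAt ℂ (fun _ : Fin (2 * p) => G) (wordSlice ax u) :=
    fun u => wordSlice_colourChangeAt (fun _ : Fin n => G) ax u
  -- the Hodge operator `Θ` of `H¹(A × C)`: `diag(±1)` in the adapted letters
  obtain ⟨Θ, hΘ⟩ := exists_hodgeTheta (BettiUniverse.hodge hHD hXP 1)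
  have hΘb : ∀ m, Θ (cbσ m) = (if κ m = 0 then (1 : ℂ) else -1) • cbσ m := by
    intro m
    rw [hcbσ]
    change Θ _ = (if (φ m).2 = 0 then (1 : ℂ) else -1) • _
    rcases fin2_eq_zero_or_one'' (φ m).2 with h0 | h1
    · rw [h0, if_pos rfl]
      have hmem : cbx (φ m) ∈ (BettiUniverse.hodge hHD hXP 1).piece 1 (((1 : ℕ) : ℤ) - 1) := by
        have e : (((1 : ℕ) : ℤ) - 1) = 0 := by norm_num
        have hsplit : φ m = ((φ m).1, 0) := by rw [← h0]
        rw [e, hsplit]; exact hcbx0 _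
      rw [hΘ 1 _ hmem]
      norm_num
    · rw [h1, if_neg one_ne_zero]
      have hmem : cbx (φ m) ∈ (BettiUniverse.hodge hHD hXP 1).piece 0 (((1 : ℕ) : ℤ) - 0) := by
        have e : (((1 : ℕ) : ℤ) - 0) = 1 := by norm_num
        have hsplit : φ m = ((φ m).1, 1) := by rw [← h1]
        rw [e, hsplit]; exact hcbx1 _
      rw [hΘ 0 _ hmem]
      norm_num
  have hΘcb : LinearMap.toMatrix cbσ cbσ Θ = kindDiag κ := by
    ext i m
    rw [LinearMap.toMatrix_apply, hΘb, map_smul, Module.Basis.repr_self, Finsupp.smul_apply,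
      Finsupp.single_apply, kindDiag, Matrix.diagonal_apply, smul_eq_mul, mul_ite, mul_one, mul_zero]
    by_cases him : i = m
    · subst him; rw [if_pos rfl]
    · rw [if_neg (Ne.symm him), if_neg him]
  have hJG : LinearMap.toMatrix eC eC Θ * G = G * kindDiag κ := by
    rw [← hΘcb, hG, linearMap_toMatrix_mul_basis_toMatrix, basis_toMatrix_mul_linearMap_toMatrix]
  have hΘq : ∀ u : Fin (2 * p) → Fin n, wordDerAt ℂ (fun _ : Fin (2 * p) => LinearMap.toMatrix eC eC Θ)
      (wordSlice (fun w => algebraMap ℚ ℂ (q' w)) u) = 0 := by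
    intro u
    rw [← haEq, hslice_e]
    refine wordDerAt_wordRepAt_eq_zero_of_mul_eq ℂ (fun _ : Fin (2 * p) => G) (fun _ => hJG) ?_
    rw [wordDerAt_const]
    exact wordDer_kindDiag_wordSlice_eq_zero κ hax_bal u
  -- the CM commutant of `C` and Riemann: the Hodge endomorphisms `s^*`, `s ∈ S`
  obtain ⟨S, hScomm, hSF⟩ := IsOfCMType.exists_commutant_comm hC
  set aF₂ : S → (BettiUniverse.hodge hHD hXC 1).endAlg := fun s =>
    ⟨MulOpposite.unop (bettiRep C (s : C.endAlgebra)), unop_bettiRep_mem_endAlg hHD hI (s : C.endAlgebra)⟩ with haF₂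
  have hF₂ : ∀ Y Y' : Module.End ℚ (bettiCohomology C.X 1),
      (∀ s, Y * (aF₂ s : Module.End ℚ (bettiCohomology C.X 1)) = (aF₂ s : Module.End ℚ (bettiCohomology C.X 1)) * Y) →
      (∀ s, Y' * (aF₂ s : Module.End ℚ (bettiCohomology C.X 1)) = (aF₂ s : Module.End ℚ (bettiCohomology C.X 1)) * Y') →
      Y * Y' = Y' * Y :=
    fun Y Y' hY hY' => hSF Y Y' (fun s => hY s) (fun s => hY' s)
  -- the coefficient function, refined to slot-and-place colours
  refine ⟨placeRefine φ ax, ?_, fun U τ N hN => ?_⟩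
  · rw [← hcax]
    have hx : (fun jr : (Fin n × (T ⊕ Fin h)) × Fin 2 => avLetters g v (jr.1.1, φ.symm (jr.1.2, jr.2))) =
        fun jr : (Fin n × (T ⊕ Fin h)) × Fin 2 => complexBetti.map (g jr.1.1).hom.hom.hom 1
          (Sum.elim
            (fun τ => complexBetti.map (Motives.AbelianVariety.fst A C).hom.hom.hom 1
              (ofRatClassBaseChange (Motives.ComplexPoints A.X) 1 (b τ jr.2 : ℂ ⊗[ℚ] bettiCohomology A.X 1)))
            (fun i => complexBetti.map (Motives.AbelianVariety.snd A C).hom.hom.hom 1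
              (ofRatClassBaseChange (Motives.ComplexPoints C.X) 1 (cC (i, jr.2))))
            jr.1.2) := by
      funext jr
      rw [avLetters_apply, hv_apply, Equiv.apply_symm_apply, hcbx]
      obtain ⟨⟨j, t⟩, r⟩ := jr
      rcases t with τ | i
      · simp only [Sum.elim_inl]
        congr 1
        rw [hι₁, ← ofRatClassBaseChangeEquiv_apply (hX := hXP), ← ofRatClassBaseChangeEquiv_apply (hX := hXA),
          complexBetti_map_ofRatClassBaseChangeEquiv hXP hXA]
      · simp only [Sum.elim_inr]
        congr 1
        rw [hι₂, ← ofRatClassBaseChangeEquiv_apply (hX := hXP), ← ofRatClassBaseChangeEquiv_apply (hX := hXC),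
          complexBetti_map_ofRatClassBaseChangeEquiv hXP hXC]
    rw [← hx]
    exact wordEval_placeRefine _ φ (avLetters g v) ax
  · refine wordDerAt_colourOp_placeRefine_eq_zero φ (Sum.inl τ) N (fun u => ?_) U
    -- the product Lie step for `Y := pr_A^* ∘ (0 ⊕ N ⊕ 0 at place τ) ∘ ι_A^*`
    set Y := ι₁.baseChange ℂ ∘ₗ RealPlaces.assemble hint b (Pi.single τ N) ∘ₗ π₁.baseChange ℂ with hY
    have htr : ∀ τ', ((Pi.single τ N : T → Matrix (Fin 2) (Fin 2) ℂ) τ').trace = 0 := by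
      intro τ'
      rw [Pi.single_apply]
      split_ifs
      · exact hN
      · exact Matrix.trace_zero _ _
    have hL := wordDerAt_assemble_eq_zero_of_semisimple_times_abelian hodd (BettiUniverse.hodge hHD hXP 1) (BettiUniverse.hodge hHD hXA 1) (BettiUniverse.hodge hHD hXC 1) hπι₁ hπι₂ hπ₁ι₂ hπ₂ι₁ hsum
      hι₁F hι₂F ψ hself σ hreal hint h2 b aF₂ hF₂ eQ q' hΘ hΘq (Pi.single τ N) htr u
    rw [← haEq, hslice_e] at hL
    have hYG : ∀ _t : Fin (2 * p), LinearMap.toMatrix eC eC Y * G = G * LinearMap.toMatrix cbσ cbσ Y :=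
      fun _ => by rw [hG, linearMap_toMatrix_mul_basis_toMatrix, basis_toMatrix_mul_linearMap_toMatrix]
    -- the matrix of `Y` in the block letters: `N` at the places `(j, inl τ)`, `0` elsewhere
    have e11 : ∀ x, π₁.baseChange ℂ (ι₁.baseChange ℂ x) = x := fun x => by
      rw [← LinearMap.comp_apply (f := π₁.baseChange ℂ), hπι₁C, LinearMap.id_apply]
    have e12 : ∀ y, π₁.baseChange ℂ (ι₂.baseChange ℂ y) = 0 := fun y => by
      rw [← LinearMap.comp_apply (f := π₁.baseChange ℂ), hπ₁ι₂C, LinearMap.zero_apply]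
    have hblk : LinearMap.toMatrix cbσ cbσ Y = blockLift φ (Pi.single (Sum.inl τ) N) := by
      refine toMatrix_eq_blockLift_of_apply_basis φ cbσ _ Y fun m => ?_
      rw [hcbσ m]
      have hb' : ∀ a, cbσ (φ.symm ((φ m).1, a)) = cbx ((φ m).1, a) := fun a => by
        rw [hcbσ, Equiv.apply_symm_apply]
      simp only [hb']
      obtain ⟨t, r⟩ := φ m
      rcases t with τ' | i
      · simp only [hcbx, Sum.elim_inl]
        rw [hY, LinearMap.comp_apply, LinearMap.comp_apply, e11,
          RealPlaces.assemble_apply_basis, map_sum]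
        refine Finset.sum_congr rfl fun a _ => ?_
        rw [map_smul, Pi.single_apply, Pi.single_apply]
        by_cases hτ : τ' = τ
        · subst hτ; simp
        · simp [hτ]
      · simp only [hcbx, Sum.elim_inr]
        rw [hY, LinearMap.comp_apply, LinearMap.comp_apply, e12, map_zero, map_zero]
        symm
        refine Finset.sum_eq_zero fun a _ => ?_
        rw [Pi.single_eq_of_ne (Sum.inr_ne_inl), Matrix.zero_apply, zero_smul]
    have h3 : wordRepAt ℂ (fun _ : Fin (2 * p) => G)
        (wordDerAt ℂ (fun _ : Fin (2 * p) => blockLift φ (Pi.single (Sum.inl τ) N)) (wordSlice ax u)) = 0 := by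
      rw [← hblk, wordRepAt_wordDerAt_of_mul_eq ℂ (fun _ : Fin (2 * p) => G) hYG, hL]
    exact wordRepAt_injective ℂ (g := fun _ : Fin (2 * p) => G) (g' := fun _ : Fin (2 * p) => G')
      (funext fun _ => hG'G) (by rw [h3, map_zero])

end Invariance

end Literature.AlgebraicGeometry.HodgeTheory

end
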